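import Literature.Probability.Percolation.FiveArmUniquenessHexagon
import HarnessLib

/-!
# The centred landed five-arm probability is `O(N⁻²)`, given outward extension (Nolin's counting)

Topic `Literature/Probability/Percolation`; family `crit-perc`. PROOFS ONLY. The COUNTING step of
the five-arm upper bound `α₅ ≤ 2` (P. Nolin, *Near-critical percolation in two dimensions*, EJP 13
(2008), §5.2, proof of Thm. 24 [arXiv 0711.4948, pp. 16–17]:

> "it is clear that `P_{1/2}(v ⇝^{5,σ} ∂S_N) ≍ P_{1/2}(0 ⇝^{5,σ} ∂S_N)` uniformly in `N`,
> `v ∈ S_{N/2}` … `1 ≥ P_{1/2}(∪_{v ∈ S_{N/2}} A_v) = Σ_{v ∈ S_{N/2}} P_{1/2}(A_v) ≍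
> N² P_{1/2}(0 ⇝^{5,σ} ∂S_N)`, which provides the upper bound";

H. Kesten, V. Sidoravicius, Y. Zhang, EJP 3 (1998), proof of Lemma 5, (3.11)–(3.13)), made
unconditional in everything but its one analytic input. The tree has `Σ_{v} P(A_v) ≤ 1` for the
landed events `A_v` of the hexagon `Λ_{2n}` (`sum_real_fiveArmLanding_triBall_le_one`,
`mul_sum_real_fiveArmLandingArms_le_one`: uniqueness, no probability), so that
`Σ_{v ∈ Λ_n} P_{1/2}(arms of A_v in Λ_{2n}) ≤ 2`, and `|Λ_n| ≥ n²`; hence ANY quantity `U(n)` with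
`c · U(n) ≤ P_{1/2}(arms of A_v in Λ_{2n})` for all `v ∈ Λ_n` — Nolin's "uniformly in
`v ∈ S_{N/2}`", which for `U(n) = P_{1/2}(0 ⇝^{5,σ} ∂Λ_n)` is the OUTWARD EXTENSION of five
(fenced) landed arms from `∂Λ_n` to the sides of the off-centre hexagon `Λ_{2n} - v ⊇ Λ_n`
(arm separation, Nolin Thm. 11 and Prop. 12 [arXiv Thm. 10, Prop. 11]; KSZ (3.12)) — satisfies
`U(n) ≤ (2/c) n⁻²`.

* `sq_le_card_triBall` — `n² ≤ |Λ_n|` (the sites `(a, -b)`, `0 ≤ a, b < n`);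
* `sum_real_fiveArmLandingArms_triBall_le_two` — `Σ_{v ∈ V} P_{1/2}(arms of A_v in Λ_N) ≤ 2`;
* `le_div_sq_of_outer_extension` — **the counting bound**.

## References

* P. Nolin, Near-critical percolation in two dimensions, *Electron. J. Probab.* 13 (2008)
  1562–1623, §5.2, proof of Thm. 24 (arXiv 0711.4948: pp. 16–17) [Nolin2008].
* H. Kesten, V. Sidoravicius, Y. Zhang, Almost all words are seen in critical site percolation on
  the triangular lattice, *Electron. J. Probab.* 3 (1998), proof of Lemma 5, (3.11)–(3.13)
  [KestenSidoraviciusZhang1998].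

## Mathlib / tree

Tree: `fiveArmLandingArms`, `mul_sum_real_fiveArmLandingArms_le_one`, `landingMeet_triBall_two`,
`landingMeet_triBall_three`, `hexSides` (`FiveArmUniqueness(Hexagon).lean`), `triBall`,
`mem_triBall_iff`, `triNorm_le_iff`. Mathlib: `Finset.card_le_card_of_injOn`, `Finset.sum_le_sum`.
-/

noncomputable section

open Set MeasureTheory

namespace Literature.Probability.Percolation

open LatticeModels

/-- **`n² ≤ |Λ_n|`**: the sites `(a, -b)` with `0 ≤ a, b < n` are distinct sites of `Λ_n`
(`|(a,-b)|_𝕋 = max(a, b, |a - b|) < n`). [folklore] -/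
theorem sq_le_card_triBall (n : ℕ) : n ^ 2 ≤ (triBall n).card := by
  classical
  let f : ℕ × ℕ → Site 2 := fun ab => ![(ab.1 : ℤ), -(ab.2 : ℤ)]
  have hinj : Set.InjOn f ↑(Finset.range n ×ˢ Finset.range n) := by
    rintro ⟨a, b⟩ - ⟨a', b'⟩ - h
    have h0 := congrArg (fun w : Site 2 => w 0) h
    have h1 := congrArg (fun w : Site 2 => w 1) h
    simp only [f, Matrix.cons_val_zero, Matrix.cons_val_one, Matrix.cons_val_fin_one, Nat.cast_inj,
      neg_inj] at h0 h1
    rw [h0, h1]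
  have hmaps : ∀ ab ∈ Finset.range n ×ˢ Finset.range n, f ab ∈ triBall n := by
    rintro ⟨a, b⟩ hab
    rw [Finset.mem_product, Finset.mem_range, Finset.mem_range] at hab
    rw [mem_triBall_iff, triNorm_le_iff]
    simp only [f, Matrix.cons_val_zero, Matrix.cons_val_one, Matrix.cons_val_fin_one]
    refine ⟨?_, ?_, ?_⟩ <;> rw [abs_le] <;> constructor <;> omega
  have h := Finset.card_le_card_of_injOn f hmaps hinj
  rwa [Finset.card_product, Finset.card_range, ← sq] at h

/-- **`Σ_{v ∈ V} P_{1/2}(arms of A_v in Λ_N) ≤ 2`** (the black centre is free and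
`Σ_v P_{1/2}(A_v) ≤ 1`, `mul_sum_real_fiveArmLandingArms_le_one` at `p = 1/2`). [cite: Nolin2008, §5.2, proof of Thm. 24 (arXiv 0711.4948: p. 17, first display)] [cite: KestenSidoraviciusZhang1998, proof of Lemma 5, (3.11)] -/
theorem sum_real_fiveArmLandingArms_triBall_le_two (N : ℕ) (V : Finset (Site 2)) :
    ∑ v ∈ V, (triSitePercolation half).real (fiveArmLandingArms ↑(triBall N) (hexSides N) v) ≤ 2 := by
  have h := mul_sum_real_fiveArmLandingArms_le_one half (triBall N) (I := hexSides N)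
    (landingMeet_triBall_two N) (landingMeet_triBall_three N) V
  have hhalf : ((half : unitInterval) : ℝ) = 1 / 2 := by simp [half]
  rw [hhalf] at h
  linarith

/-- **Nolin's counting bound.** If `U(n)` is, up to the constant `c > 0`, a lower bound of the
probability of the arms of `A_v` in the hexagon `Λ_{2n}` for EVERY centre `v ∈ Λ_n` and all
`n ≥ n₀` (for `U(n) = P_{1/2}(0 ⇝^{5,σ} ∂Λ_n)` this is the outward extension "uniformly in
`v ∈ S_{N/2}`" of Nolin's proof, from arm separation), then `U(n) ≤ (2/c)/n²` for `n ≥ n₀`,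
`n ≥ 1`: `n² · c U(n) ≤ Σ_{v ∈ Λ_n} P(arms of A_v in Λ_{2n}) ≤ 2`. [cite: Nolin2008, §5.2, proof of Thm. 24 (arXiv 0711.4948: pp. 16–17, "N² P(0 ⇝ ∂S_N) ≲ 1")] [cite: KestenSidoraviciusZhang1998, proof of Lemma 5, (3.11)–(3.13)] -/
theorem le_div_sq_of_outer_extension {U : ℕ → ℝ} {c : ℝ} (hc : 0 < c) {n₀ : ℕ}
    (hext : ∀ n : ℕ, n₀ ≤ n → ∀ v ∈ triBall n,
      c * U n ≤ (triSitePercolation half).real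
        (fiveArmLandingArms ↑(triBall (2 * n)) (hexSides (2 * n)) v))
    {n : ℕ} (hn : n₀ ≤ n) (hn1 : 1 ≤ n) : U n ≤ 2 / c / (n : ℝ) ^ 2 := by
  have hsum := sum_real_fiveArmLandingArms_triBall_le_two (2 * n) (triBall n)
  have hcard : ((n : ℝ)) ^ 2 ≤ (triBall n).card := by exact_mod_cast sq_le_card_triBall n
  have hlow : ((triBall n).card : ℝ) * (c * U n) ≤
      ∑ v ∈ triBall n, (triSitePercolation half).real
        (fiveArmLandingArms ↑(triBall (2 * n)) (hexSides (2 * n)) v) := by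
    rw [← nsmul_eq_mul, ← Finset.sum_const]
    exact Finset.sum_le_sum fun v hv => hext n hn v hv
  have hn2 : (0 : ℝ) < (n : ℝ) ^ 2 := by positivity
  have key : (n : ℝ) ^ 2 * (c * U n) ≤ 2 := by
    by_cases hU : 0 ≤ c * U n
    · exact ((mul_le_mul_of_nonneg_right hcard hU).trans hlow).trans hsum
    · rw [not_le] at hU
      exact (mul_neg_of_pos_of_neg hn2 hU).le.trans (by norm_num)
  rw [le_div_iff₀ hn2, div_eq_mul_inv, le_mul_inv_iff₀ hc]
  calc U n * (n : ℝ) ^ 2 * c = (n : ℝ) ^ 2 * (c * U n) := by ring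
    _ ≤ 2 := key

end Literature.Probability.Percolation
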